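/-
Copyright: rh-split cell (screw, prover seat l19) gen 0, 2026-08-27.  Splitting search over kernel-typed
RH-equivalences.  A splitting `A ∧ B ⟹ RH` is CONDITIONAL bookkeeping unless `A` and `B` are both
proved; nothing here bears on the truth of RH.
-/
import Summits.RiemannHypothesis.RiemannHypothesis.Theorems.Splittings.ScrewLatticeContinuationA
import Literature.Analysis.Complex.PringsheimNonnegativeCoefficients
import HarnessLib

/-!
# Route X-15 `ScrewPringsheim` — the PRINGSHEIM BRIDGE (item `PringsheimBridge`, RH-free): a one-sided
sub-exponential lattice floor plus a ray-free wall give the two-sided lattice ceiling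

Objects of `ScrewLatticeContinuation` (row X-9): step `h > 0`, Suzuki's screw function `Ψ = zetaScrew`,
the lattice generating function `P_h(z) = ∑_k Ψ(k h) z^k` (`latticeGF`; equal to the Borel series
`B_h = ∑_ρ term (c_ρ) (u_ρ)` for `‖z‖ < e^{-h/2}`, `latticeGF_eq_borel`), the aliased pole field
`aliasedPoleSet h` (= `poleSet (mult h)`) with closure `T_h`, and `CEIL(h)` = `LatticeCeiling h`
(`|Ψ(k h)| ≤ K_ε e^{ε k}`).

**Theorem** (`latticeCeiling_of_floor_of_rayFree`, the statement of `Theses.ScrewPringsheim.PringsheimBridge`).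
For `h > 0`: if `Ψ` has a SUB-EXPONENTIAL FLOOR on the lattice `hℕ` (`∀ η > 0 ∃ K ∀ k, -K e^{η k h} ≤ Ψ(k h)`)
and the closed wall `T_h` contains no point of the real ray `[0, 1)`, then `CEIL(h)`.

Proof (Vivanti–Pringsheim on the shifted samples).
* (P0) `hasSum_latticeGF`: for `‖z‖ < e^{-h/2}` the series `∑ Ψ(kh) z^k` converges (unconditional bound
  `|Ψ(t)| ≤ S e^{|t|/2}`, `ScrewGradedFloor.abs_zetaScrew_le_exp_of_strip` at `η = 1/2`).
* (P1) `raySummable`: at floor level `η` with constant `K`, the coefficients `a_k = Ψ(kh) + K e^{η k h}` are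
  `≥ 0`; the function `F = B_h + K/(1 - e^{η h} z)` is analytic at every real `t ∈ [0, e^{-η h})`
  (`ScrewBorel.differentiableOn_borel` on the open set `𝔻 ∖ T_h ∋ t` by ray-freeness) and equals `∑ a_k t^k`
  for small `t > 0`; the Vivanti–Pringsheim theorem
  (`Literature.Analysis.Complex.summable_mul_pow_of_nonneg_of_analyticAt`) gives convergence of
  `∑ a_k t^k` for every `t ∈ [0, e^{-η h})`.
* (P2) `latticeCeiling_of_raySummable`: with `η = ε/(2h)` and `t = e^{-ε}`: `a_k e^{-ε k} ≤ ∑_j a_j t^j = T`,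
  so `Ψ(kh) ≤ T e^{ε k}`; the floor gives `Ψ(kh) ≥ -|K| e^{ε k}`; hence `|Ψ(kh)| ≤ (T + |K|) e^{ε k}`.

RH is not proved by this: `PringsheimBridge` is the RH-free leg of the CONDITIONAL splitting X-15
`PringsheimBridge ∧ RayFreeThinWall ∧ Floor ⟹ RH` (`RayFreeThinWall`, `Floor` open conjectures).
No `sorry`, no new axioms, no instances, no notation.
-/

set_option linter.dupNamespace false

namespace Summit.RiemannHypothesis.RiemannHypothesis.Theorems.Splittings.ScrewLatticePringsheim

open Complex Filter Topology Set Metric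
open Literature.NumberTheory.LFunctions
open ZetaZeros.riemannZetaNontrivialZeros
open Summit.RiemannHypothesis.RiemannHypothesis.Theorems.Splittings
open Summit.RiemannHypothesis.RiemannHypothesis.Theorems.Splittings.ScrewBorel
open Summit.RiemannHypothesis.RiemannHypothesis.Theorems.Splittings.ScrewLatticeContinuation

/-! ## (P0) The lattice generating function as a convergent power series near `0` -/

/-- **Unconditional growth of `Ψ`**: `|Ψ(t)| ≤ S e^{|t|/2}` (every zero has `|Re ρ - 1/2| ≤ 1/2`). -/
theorem exists_abs_zetaScrew_le_exp_half :
    ∃ S : ℝ, 0 ≤ S ∧ ∀ t : ℝ, |zetaScrew t| ≤ S * Real.exp (1 / 2 * |t|) := by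
  refine ScrewGradedFloor.abs_zetaScrew_le_exp_of_strip (by norm_num) fun ρ hρ ↦ ?_
  have h0 := re_pos hρ
  have h1 := re_lt_one hρ
  rw [abs_le]
  constructor <;> linarith

/-- **(P0)** For `h > 0` and `‖z‖ < e^{-h/2}` the lattice generating series converges:
`HasSum (k ↦ Ψ(k h) z^k) (latticeGF h z)`. -/
theorem hasSum_latticeGF {h : ℝ} (hh : 0 < h) {z : ℂ} (hz : ‖z‖ < Real.exp (-(h / 2))) :
    HasSum (fun k : ℕ ↦ (zetaScrew (k * h) : ℂ) * z ^ k) (latticeGF h z) := by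
  obtain ⟨S, hS0, hS⟩ := exists_abs_zetaScrew_le_exp_half
  set q : ℝ := Real.exp (h / 2) * ‖z‖ with hq
  have hq0 : 0 ≤ q := by positivity
  have hq1 : q < 1 := by
    calc q < Real.exp (h / 2) * Real.exp (-(h / 2)) := by rw [hq]; gcongr
      _ = 1 := by rw [← Real.exp_add]; simp
  have hsum : Summable fun k : ℕ ↦ (zetaScrew (k * h) : ℂ) * z ^ k := by
    refine Summable.of_norm_bounded ((summable_geometric_of_lt_one hq0 hq1).mul_left S) (fun k ↦ ?_)
    rw [norm_mul, norm_pow, Complex.norm_real, Real.norm_eq_abs]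
    have hkh : 0 ≤ (k : ℝ) * h := by positivity
    have h1 := hS (k * h)
    rw [abs_of_nonneg hkh] at h1
    have h2 : Real.exp (1 / 2 * ((k : ℝ) * h)) = Real.exp (h / 2) ^ k := by
      rw [← Real.exp_nat_mul]; ring_nf
    calc |zetaScrew (k * h)| * ‖z‖ ^ k ≤ (S * Real.exp (1 / 2 * ((k : ℝ) * h))) * ‖z‖ ^ k := by
          gcongr
      _ = S * q ^ k := by rw [h2, hq, mul_pow]; ring
  exact hsum.hasSum

/-! ## (P1) Vivanti–Pringsheim along the ray -/

/-- **(P1) Ray summability.**  `h > 0`, `η > 0`, a floor `-K e^{η k h} ≤ Ψ(k h)` and a wall `T_h` missing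
the ray `[0,1)`: the shifted non-negative series `∑ (Ψ(kh) + K e^{η k h}) t^k` converges for every real
`t ∈ [0, e^{-η h})`. -/
theorem raySummable {h : ℝ} (hh : 0 < h) {η : ℝ} (hη : 0 < η) {K : ℝ}
    (hfloor : ∀ k : ℕ, -K * Real.exp (η * (k * h)) ≤ zetaScrew (k * h))
    (hray : ∀ t : ℝ, 0 ≤ t → t < 1 → ((t : ℂ)) ∉ closure (aliasedPoleSet h))
    {t : ℝ} (ht0 : 0 ≤ t) (htb : t < Real.exp (-(η * h))) :
    Summable (fun k : ℕ ↦ (zetaScrew (k * h) + K * Real.exp (η * (k * h))) * t ^ k) := by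
  -- data for the Vivanti–Pringsheim theorem
  set a : ℕ → ℝ := fun k ↦ zetaScrew (k * h) + K * Real.exp (η * (k * h)) with ha_def
  set w : ℝ := Real.exp (η * h) with hw
  have hw0 : 0 < w := Real.exp_pos _
  have hwb : Real.exp (-(η * h)) = w⁻¹ := by rw [hw, Real.exp_neg]
  have hb1 : Real.exp (-(η * h)) < 1 := Real.exp_lt_one_iff.2 (by nlinarith)
  set F : ℂ → ℂ := fun z ↦ (∑' ρ : ZetaZeros.riemannZetaNontrivialZeros, term (coeff ρ) (mult h ρ) z) +
    (K : ℂ) * (1 - (w : ℂ) * z)⁻¹ with hF_def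
  have ha : ∀ k, 0 ≤ a k := fun k ↦ by
    have := hfloor k
    simp only [ha_def]
    linarith
  -- `F` is analytic at every real point of `[0, e^{-η h})`
  have hF : ∀ s : ℝ, 0 ≤ s → s < Real.exp (-(η * h)) → AnalyticAt ℂ F s := by
    intro s hs0 hsb
    have hs1 : s < 1 := hsb.trans hb1
    -- the Borel series
    have hU : IsOpen (ball (0 : ℂ) 1 \ closure (poleSet (mult h))) :=
      isOpen_ball.sdiff isClosed_closure
    have hsU : (s : ℂ) ∈ ball (0 : ℂ) 1 \ closure (poleSet (mult h)) := by
      refine ⟨?_, hray s hs0 hs1⟩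
      rw [mem_ball_zero_iff, Complex.norm_real, Real.norm_eq_abs, abs_of_nonneg hs0]
      exact hs1
    have hB : AnalyticAt ℂ
        (fun z ↦ ∑' ρ : ZetaZeros.riemannZetaNontrivialZeros, term (coeff ρ) (mult h ρ) z) s :=
      (differentiableOn_borel summable_norm_coeff (mult_ne_zero h)).analyticAt (hU.mem_nhds hsU)
    -- the auxiliary pole `K/(1 - w z)` (`w s < 1`)
    have hden : (1 : ℂ) - (w : ℂ) * (s : ℂ) ≠ 0 := by
      have hws : w * s < 1 := by
        have : s < w⁻¹ := by rwa [hwb] at hsb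
        calc w * s < w * w⁻¹ := by gcongr
          _ = 1 := mul_inv_cancel₀ hw0.ne'
      have e : (1 : ℂ) - (w : ℂ) * (s : ℂ) = ((1 - w * s : ℝ) : ℂ) := by push_cast; ring
      rw [e, Ne, Complex.ofReal_eq_zero]
      linarith
    have hR : AnalyticAt ℂ (fun z : ℂ ↦ (K : ℂ) * (1 - (w : ℂ) * z)⁻¹) s :=
      analyticAt_const.mul
        ((analyticAt_const.sub (analyticAt_const.mul analyticAt_id)).inv hden)
    exact hB.add hR
  -- the germ: for `0 < s < min (e^{-h/2}) (e^{-η h})`, `∑ a_k s^k = F s`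
  have hε : 0 < min (Real.exp (-(h / 2))) (Real.exp (-(η * h))) :=
    lt_min (Real.exp_pos _) (Real.exp_pos _)
  have hgerm : ∀ s : ℝ, 0 < s → s < min (Real.exp (-(h / 2))) (Real.exp (-(η * h))) →
      HasSum (fun k ↦ (a k : ℂ) * (s : ℂ) ^ k) (F s) := by
    intro s hs0 hsε
    have hs₁ : s < Real.exp (-(h / 2)) := hsε.trans_le (min_le_left _ _)
    have hs₂ : s < Real.exp (-(η * h)) := hsε.trans_le (min_le_right _ _)
    have hns : ‖(s : ℂ)‖ = s := by rw [Complex.norm_real, Real.norm_eq_abs, abs_of_pos hs0]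
    -- Ψ-part
    have h1 : HasSum (fun k : ℕ ↦ (zetaScrew (k * h) : ℂ) * (s : ℂ) ^ k)
        (∑' ρ : ZetaZeros.riemannZetaNontrivialZeros, term (coeff ρ) (mult h ρ) s) := by
      rw [← latticeGF_eq_borel hh (by rw [hns]; exact hs₁)]
      exact hasSum_latticeGF hh (by rw [hns]; exact hs₁)
    -- K-part (geometric series with ratio `w s < 1`)
    have hws : ‖(w : ℂ) * (s : ℂ)‖ < 1 := by
      rw [norm_mul, Complex.norm_real, Real.norm_eq_abs, abs_of_pos hw0, hns]
      have : s < w⁻¹ := by rwa [hwb] at hs₂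
      calc w * s < w * w⁻¹ := by gcongr
        _ = 1 := mul_inv_cancel₀ hw0.ne'
    have h2 := (hasSum_geometric_of_norm_lt_one hws).mul_left (K : ℂ)
    convert h1.add h2 using 1
    funext k
    have e : Real.exp (η * (k * h)) = w ^ k := by
      rw [hw, ← Real.exp_nat_mul]; ring_nf
    simp only [ha_def, e]
    push_cast
    ring
  -- Vivanti–Pringsheim
  exact Literature.Analysis.Complex.summable_mul_pow_of_nonneg_of_analyticAt ha hF hε hgerm ht0 htb

/-! ## (P2) From ray summability to the two-sided ceiling -/

/-- **(P2)**  If at every floor level `η > 0` some floor constant `K` makes `∑ (Ψ(kh) + K e^{η k h}) t^k`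
converge for all `t ∈ [0, e^{-η h})`, then `CEIL(h)`. -/
theorem latticeCeiling_of_raySummable {h : ℝ} (hh : 0 < h)
    (H : ∀ η : ℝ, 0 < η → ∃ K : ℝ, (∀ k : ℕ, -K * Real.exp (η * (k * h)) ≤ zetaScrew (k * h)) ∧
      ∀ t : ℝ, 0 ≤ t → t < Real.exp (-(η * h)) →
        Summable (fun k : ℕ ↦ (zetaScrew (k * h) + K * Real.exp (η * (k * h))) * t ^ k)) :
    LatticeCeiling h := by
  intro ε hε
  obtain ⟨K, hfloor, hsum⟩ := H (ε / (2 * h)) (by positivity)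
  have hηh : ε / (2 * h) * h = ε / 2 := by field_simp
  set t : ℝ := Real.exp (-ε) with ht
  have ht0 : 0 ≤ t := (Real.exp_pos _).le
  have htb : t < Real.exp (-(ε / (2 * h) * h)) := by
    rw [hηh, ht]
    exact Real.exp_lt_exp.2 (by linarith)
  have hs := hsum t ht0 htb
  set a : ℕ → ℝ := fun k ↦ zetaScrew (k * h) + K * Real.exp (ε / (2 * h) * (k * h)) with ha_def
  have ha0 : ∀ k, 0 ≤ a k := fun k ↦ by
    have := hfloor k
    simp only [ha_def]
    linarith
  have hterm0 : ∀ j, 0 ≤ a j * t ^ j := fun j ↦ mul_nonneg (ha0 j) (pow_nonneg ht0 j)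
  set T : ℝ := ∑' j, a j * t ^ j with hT
  have hT0 : 0 ≤ T := tsum_nonneg hterm0
  have hle : ∀ k, a k * t ^ k ≤ T := fun k ↦ hs.le_tsum k fun j _ ↦ hterm0 j
  refine ⟨T + |K|, fun k ↦ ?_⟩
  have htk : t ^ k = Real.exp (-(ε * k)) := by
    rw [ht, ← Real.exp_nat_mul]; ring_nf
  have e1 : Real.exp (-(ε * k)) * Real.exp (ε * k) = 1 := by
    rw [← Real.exp_add]; simp
  have hexp0 : 0 < Real.exp (ε * k) := Real.exp_pos _
  -- upper bound: `a k ≤ T e^{ε k}`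
  have hup : a k ≤ T * Real.exp (ε * k) := by
    have h1 := hle k
    rw [htk] at h1
    calc a k = (a k * Real.exp (-(ε * k))) * Real.exp (ε * k) := by rw [mul_assoc, e1, mul_one]
      _ ≤ T * Real.exp (ε * k) := mul_le_mul_of_nonneg_right h1 hexp0.le
  -- the floor term: `|K e^{(ε/2) k}| ≤ |K| e^{ε k}`
  have hexp : Real.exp (ε / (2 * h) * (k * h)) ≤ Real.exp (ε * k) := by
    refine Real.exp_le_exp.2 ?_
    have e : ε / (2 * h) * ((k : ℝ) * h) = ε / 2 * k := by
      field_simp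
    rw [e]
    have : (0 : ℝ) ≤ ε * k := by positivity
    linarith
  have hK1 : K * Real.exp (ε / (2 * h) * (k * h)) ≤ |K| * Real.exp (ε * k) :=
    mul_le_mul (le_abs_self K) hexp (Real.exp_pos _).le (abs_nonneg K)
  have hK2 : -(|K| * Real.exp (ε * k)) ≤ K * Real.exp (ε / (2 * h) * (k * h)) := by
    have h1 : -|K| * Real.exp (ε / (2 * h) * (k * h)) ≤ K * Real.exp (ε / (2 * h) * (k * h)) :=
      mul_le_mul_of_nonneg_right (neg_abs_le K) (Real.exp_pos _).le
    have h2 : |K| * Real.exp (ε / (2 * h) * (k * h)) ≤ |K| * Real.exp (ε * k) :=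
      mul_le_mul_of_nonneg_left hexp (abs_nonneg K)
    linarith
  have hψ : zetaScrew (k * h) = a k - K * Real.exp (ε / (2 * h) * (k * h)) := by
    simp only [ha_def]; ring
  have hfl := hfloor k
  rw [abs_le]
  constructor
  · nlinarith
  · nlinarith

/-! ## The bridge -/

/-- **PRINGSHEIM BRIDGE** (`h > 0`, RH-free) — the statement of `Theses.ScrewPringsheim.PringsheimBridge`:
a sub-exponential lattice FLOOR of `Ψ` on `hℕ` and a closed wall `T_h` missing the real ray `[0,1)` give
the two-sided ceiling `CEIL(h)`. -/
theorem latticeCeiling_of_floor_of_rayFree {h : ℝ} (hh : 0 < h)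
    (hsef : ∀ η : ℝ, 0 < η → ∃ K : ℝ, ∀ k : ℕ, -K * Real.exp (η * (k * h)) ≤ zetaScrew (k * h))
    (hray : ∀ t : ℝ, 0 ≤ t → t < 1 → ((t : ℂ)) ∉ closure (aliasedPoleSet h)) :
    LatticeCeiling h :=
  latticeCeiling_of_raySummable hh fun η hη ↦ by
    obtain ⟨K, hK⟩ := hsef η hη
    exact ⟨K, hK, fun _ ht0 htb ↦ raySummable hh hη hK hray ht0 htb⟩

end Summit.RiemannHypothesis.RiemannHypothesis.Theorems.Splittings.ScrewLatticePringsheim
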